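import Summits.FinalStateConjecture.FinalStateConjecture.Theorems.EIHFluxBalanceInertialRecessionStubWeightedRatesNecessityQS
import Summits.FinalStateConjecture.FinalStateConjecture.Theorems.WeightedQuasiStationarity.Negative.KinematicShadowCalculus
import Summits.FinalStateConjecture.FinalStateConjecture.Theorems.WeightedQuasiStationarity.Negative.KinematicShadowBoost

/-!
# Route EIHFluxBalance — item `WeightedQuasiStationarity` (stmt-FinalStateConjecture-16928):
# the KINEMATIC SHADOW of the item is false — its MGHD clauses are load-bearing and must yield a RATE

Negative-lane file of the prover seated on the route item `WeightedQuasiStationarity`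
(stmt-FinalStateConjecture-16928; the lift of stub `stub_weightedQuasiStationarity` of line
`quasistationarity-is-the-rate` of the crux `InertialRecession`, stmt-FinalStateConjecture-10166),
`--supports stmt-FinalStateConjecture-16928`. No Theses decl is asserted.

The item reads: crux antecedent (an MGHD `𝒟` of admissible data, a lab chart `Φ`, `C³` closeness to
the modulated multi-Kerr–Schild ansatz, unweighted on whole lab slabs and with weight `1 + d^{7/4}`
inside the cone) `∧ 0 < N ∧` third-order slaving `⇒` QS (quasi-stationarity of the MODULATED
BACKGROUND at the weighted rate). QS speaks about the model field only, and for one Schwarzschild hole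
its content is known exactly: it is EQUIVALENT to the weighted 4-velocity rate RATES_E0
`t^{3/4}‖(Λe₀)˙‖ → 0` (`…StubWeightedRatesReductionE0.stub_quasiStationarity_of_weightedRates_e0` ⇐,
`…StubWeightedRatesNecessityQS.weightedRate_e0_of_QS_one` ⇒).

* `not_weightedQuasiStationarity_kinematicShadow` — delete from the item every clause that mentions
  the development (`X`, `D`, `𝒟`, `U`, `Φ`, `O`, `τ₀`: the chart, the two closeness clauses, the
  exterior and causal-past clauses) and keep VERBATIM everything it says about the painted moduli
  (sub-extremality and `r₋ < rin < r₊`, Lorentz factor `≤ γ`, smoothness, pairwise separation, the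
  cone clause `‖ξᵢ(t)‖ ≤ κ²t`), the guard `0 < N`, the whole third-order slaving block and the
  conclusion QS. The resulting closed proposition is FALSE. Witness: `N = 1`, `M = 1`, `a = 0`,
  `rin = 1`, `ξ ≡ 0`, `κ = 1/2`, `γ = 2`, and the pure boost `Λ(t) = boost(w(t))` with lab velocity
  `w(t) = (1/4)·(1 + t²)^{-1/4} sin t · e₁`: `w, w', w'', w''' → 0` (so every slaving clause holds,
  the translational one with `ξ̇ − v ≡ −w`), while `t^{3/4}‖(Λe₀)˙(2πn)‖ = t^{3/4}(1+t²)^{-1/4}/4 ≥ 1/8`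
  at every `t = 2πn ≥ 1`, so RATES_E0 fails and, by `weightedRate_e0_of_QS_one`, QS fails.

Consequence for the item: any proof must extract from the MGHD clauses (Ricci-flatness of an abstract
maximal development read through `o(d^{-7/4})` `C³` closeness) a DECAY RATE of the painted boost —
no kinematic or slaving hypothesis supplies it. (The strengthening with weighted jet rates of orders
2 and 3 is `…Negative.KinematicShadowJetRates`. Where the rate comes from — see the item's evidence
note v2 of this seat, which CORRECTS the first version of this docstring: for an isolated hole or a
cluster clear at scale `≍ t` it is delivered slab-locally by the shell-integrated momentum constraint
— the Landau–Lifshitz momentum of the modulated ansatz on a lab sphere `S_R` carries the term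
`−(1/3) M R u̇` at leading order, so the perforated-Gauss identity between `S_R` and `S_{2R}` plus the
`m ≤ 1` closeness gives `M‖u̇‖ ≲ ε(t)R^{-3/4} + M²R^{-2}` — a finite but not yet landed computation;
only tight sub-clusters `D ≪ t^{3/4}` need non-slab-local input.)
-/

set_option linter.dupNamespace false

noncomputable section

namespace Summit.FinalStateConjecture.FinalStateConjecture.Theorems.WeightedQuasiStationarity.Negative

open scoped Topology ENNReal
open Filter Set Function Metric Literature.Geometry.Lorentzian
open Summit.FinalStateConjecture.FinalStateConjecture.Theorems
open Summit.FinalStateConjecture.FinalStateConjecture.Theorems.SublinearIsFree.WeightedRates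

/-! ### §6 The kinematic shadow of `WeightedQuasiStationarity` is false -/

-- operator-norm instance paths on form-valued maps are slow to unify
set_option synthInstance.maxHeartbeats 200000 in
set_option maxHeartbeats 1600000 in
/-- **The kinematic shadow of the item `WeightedQuasiStationarity` is false.** The proposition below is
the item stmt-FinalStateConjecture-16928 with every clause about the development deleted (the binders
`X`, `D`, `𝒟`, `τ₀`, `U`, `Φ`, `O`, the chart-domain inclusion and the whole `let B := …` block:
smooth open embedding, exterior inclusion, unweighted and weighted `C³` closeness, `O = exteriorOf …`,
causal-past exhaustion) and everything else kept verbatim: the five kinematic clauses on the painted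
moduli, the guard `0 < N`, the third-order slaving block, and the conclusion QS. It fails for one
Schwarzschild hole (`N = 1`, `M = 1`, `a = 0`, `rin = 1`, `γ = 2`, `κ = 1/2`, `ξ ≡ 0`) painted with the
pure boost `Λ(t) = boost(w(t))`, `w(t) = ((1/4)(1+t²)^{-1/4} sin t) • e₁`: all hypotheses hold (`w` and
its first three derivatives tend to `0`; the translational slaving expression is `−w`), and QS would
force `t^{3/4}‖(Λe₀)˙‖ → 0` (`weightedRate_e0_of_QS_one`), whereas at `t = 2πn ≥ 1` one has
`t^{3/4}‖(Λe₀)˙(t)‖ ≥ t^{3/4}‖(γ(w)w)˙(t)‖ = t^{3/4}(1/4)(1+t²)^{-1/4} ≥ 1/8`. Hence the MGHD clauses of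
the item are load-bearing, and what they must deliver is a decay RATE of the painted boost. [folklore] -/
theorem not_weightedQuasiStationarity_kinematicShadow :
    ¬ (open Literature.Geometry.Lorentzian in ∀ (N : ℕ) (M a rin : Fin N → ℝ)
      (Λ : Fin N → ℝ → lorentzGroup) (ξ : Fin N → ℝ → E3) (γ κ : ℝ),
      ((∀ i, Kerr.IsSubextremal (M i) (a i) ∧ Kerr.rMinus (M i) (a i) < rin i ∧
          rin i < Kerr.rPlus (M i) (a i)) ∧
        (∀ i t, |((Λ i t : E4 ≃L[ℝ] E4) (E4.basisVector 0)) 0| ≤ γ) ∧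
        (∀ i, ContDiff ℝ ((⊤ : ℕ∞) : WithTop ℕ∞) (ξ i) ∧
          ContDiff ℝ ((⊤ : ℕ∞) : WithTop ℕ∞) (fun t ↦ ((Λ i t : E4 ≃L[ℝ] E4) : E4 →L[ℝ] E4))) ∧
        (∀ i j, i ≠ j → Tendsto (fun t ↦ ‖ξ i t - ξ j t‖) atTop atTop) ∧
        (0 < κ ∧ κ < 1 ∧ ∀ i, ∀ᶠ t in atTop, ‖ξ i t‖ ≤ κ ^ 2 * t)) →
      0 < N →
      (∀ i : Fin N, (∀ m : ℕ, 1 ≤ m → m ≤ 3 → Tendsto (fun t ↦ iteratedDeriv m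
          (fun s ↦ (((Λ i s : lorentzGroup) : E4 ≃L[ℝ] E4) (E4.basisVector 0))) t) atTop (𝓝 0)) ∧
        (∀ m : ℕ, m ≤ 2 → Tendsto (fun t ↦ iteratedDeriv m (fun s ↦ deriv (ξ i) s -
          (((((Λ i s : lorentzGroup) : E4 ≃L[ℝ] E4) (E4.basisVector 0)) 0)⁻¹ •
            E4.spatial (((Λ i s : lorentzGroup) : E4 ≃L[ℝ] E4) (E4.basisVector 0)))) t)
              atTop (𝓝 0)) ∧
        (a i ≠ 0 → ∀ m : ℕ, 1 ≤ m → m ≤ 3 → Tendsto (fun t ↦ iteratedDeriv m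
          (fun s ↦ (((Λ i s : lorentzGroup) : E4 ≃L[ℝ] E4) (E4.basisVector 3))) t) atTop (𝓝 0))) →
      (∀ ρ : ℝ → ℝ, Tendsto ρ atTop atTop → Tendsto (fun t : ℝ ↦ ⨆ x ∈ {x : E4 | x 0 = t ∧
          E4.spatialNorm x ≤ κ * t ∧ ρ t ≤ ⨅ i, ‖E4.spatial x - ξ i t‖},
        ENNReal.ofReal (1 + √(√((⨅ i, ‖E4.spatial x - ξ i t‖) ^ 7))) *
          ‖fderiv ℝ (fun y : E4 ↦ Minkowski.bilin + ∑ i, (boostedKerrBilin (Λ i (y 0))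
            (E4.ofTimeSpace (y 0) (ξ i (y 0))) (M i) (a i) y - Minkowski.bilin)) x
              (E4.basisVector 0)‖ₑ) atTop (𝓝 0))) := by
  intro H
  -- the exponent and the amplitude with its three derivatives
  set p : ℝ := -(1 / 4 : ℝ) with hp
  have hp0 : p < 0 := by rw [hp]; norm_num
  set A : ℝ → ℝ := fun s ↦ (1 + s ^ 2) ^ p with hAdef
  set A1 : ℝ → ℝ := fun t ↦ 2 * t * p * (1 + t ^ 2) ^ (p - 1) with hA1def
  set A2 : ℝ → ℝ := fun t ↦ 2 * p * (1 + t ^ 2) ^ (p - 1) +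
    4 * p * (p - 1) * t ^ 2 * (1 + t ^ 2) ^ (p - 2) with hA2def
  set A3 : ℝ → ℝ := fun t ↦ 12 * p * (p - 1) * t * (1 + t ^ 2) ^ (p - 2) +
    8 * p * (p - 1) * (p - 2) * t ^ 3 * (1 + t ^ 2) ^ (p - 3) with hA3def
  have hA : ∀ t, HasDerivAt A (A1 t) t := fun t ↦ hasDerivAt_ampl0 p t
  have hA1 : ∀ t, HasDerivAt A1 (A2 t) t := fun t ↦ hasDerivAt_ampl1 p t
  have hA2 : ∀ t, HasDerivAt A2 (A3 t) t := fun t ↦ hasDerivAt_ampl2 p t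
  obtain ⟨l0, l1, l2, l3⟩ := tendsto_ampl hp0
  have hApos : ∀ t, 0 < A t := fun t ↦ Real.rpow_pos_of_pos (by positivity) _
  have hAle : ∀ t, A t ≤ 1 := fun t ↦
    Real.rpow_le_one_of_one_le_of_nonpos (one_le_one_add_sq t) hp0.le
  have hAsmooth : ContDiff ℝ ((⊤ : ℕ∞) : WithTop ℕ∞) A := by
    rw [contDiff_iff_contDiffAt]
    intro t
    exact (contDiffAt_const.add (contDiffAt_id.pow 2)).rpow_const_of_ne
      (by positivity : (0 : ℝ) < 1 + t ^ 2).ne'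
  -- the speed `u = ε A sin`, the axis `e`, the velocity `w = u • e`
  set ε : ℝ := 1 / 4 with hε
  set e : E3 := EuclideanSpace.single 0 1 with hedef
  have he : ‖e‖ = 1 := by rw [hedef]; simp
  set u : ℝ → ℝ := fun s ↦ ε * (A s * Real.sin s) with hudef
  set w : ℝ → E3 := fun s ↦ u s • e with hwdef
  have hub : ∀ t, |u t| ≤ 1 / 4 := fun t ↦ by
    rw [hudef]
    dsimp only
    rw [abs_mul, abs_mul, abs_of_pos (hApos t), hε, abs_of_pos (by norm_num : (0 : ℝ) < 1 / 4)]
    have := Real.abs_sin_le_one t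
    nlinarith [hAle t, hApos t, abs_nonneg (Real.sin t)]
  have hwn : ∀ t, ‖w t‖ = |u t| := fun t ↦ by
    rw [hwdef]; dsimp only; rw [norm_smul, he, mul_one, Real.norm_eq_abs]
  have hwb : ∀ t, ‖w t‖ ≤ 1 / 4 := fun t ↦ (hwn t).le.trans (hub t)
  have hw1 : ∀ t, ‖w t‖ < 1 := fun t ↦ norm_lt_one_of_le_quarter (hwb t)
  have husmooth : ContDiff ℝ ((⊤ : ℕ∞) : WithTop ℕ∞) u :=
    contDiff_const.mul (hAsmooth.mul Real.contDiff_sin)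
  have hwsmooth : ContDiff ℝ ((⊤ : ℕ∞) : WithTop ℕ∞) w := husmooth.smul contDiff_const
  -- the derivatives of `w` tend to `0`
  have hwlim : ∀ m ≤ 3, Tendsto (fun t ↦ iteratedDeriv m w t) atTop (𝓝 0) :=
    tendsto_iteratedDeriv_w hA hA1 hA2 l0 l1 l2 l3 ε e
  -- the painted frame
  set Λ : ℝ → lorentzGroup := fun t ↦ Lorentz.boost (w t) (hw1 t) with hΛdef
  have hcoe : (fun t ↦ ((Λ t : E4 ≃L[ℝ] E4) : E4 →L[ℝ] E4)) = fun t ↦ Lorentz.boostCLM (w t) := rfl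
  have hΛsmooth : ContDiff ℝ ((⊤ : ℕ∞) : WithTop ℕ∞) (fun t ↦ ((Λ t : E4 ≃L[ℝ] E4) : E4 →L[ℝ] E4)) := by
    rw [hcoe]; exact contDiff_boostCLM_comp hwsmooth hw1
  have hγ : ∀ t, |((Λ t : E4 ≃L[ℝ] E4) (E4.basisVector 0)) 0| ≤ 2 := fun t ↦ by
    change |((Lorentz.boost (w t) (hw1 t) : E4 ≃L[ℝ] E4) (E4.basisVector 0)) 0| ≤ 2
    rw [Lorentz.boost_apply_basisVector_zero_zero, abs_of_pos (Lorentz.gamma_pos (hw1 t))]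
    exact gamma_le_two (hwb t)
  -- instantiate the shadow at the witness
  have hQS := H 1 (fun _ ↦ 1) (fun _ ↦ 0) (fun _ ↦ 1) (fun _ ↦ Λ) (fun _ _ ↦ 0) 2 (1 / 2)
    ⟨fun _ ↦ ⟨by unfold Kerr.IsSubextremal; norm_num, by simp [Kerr.rMinus],
      by rw [Kerr.rPlus_zero_right zero_le_one]; norm_num⟩,
     fun _ t ↦ hγ t,
     fun _ ↦ ⟨contDiff_const, hΛsmooth⟩,
     fun i j hij ↦ absurd (Subsingleton.elim i j) hij,
     ⟨by norm_num, by norm_num, fun _ ↦ (eventually_ge_atTop 0).mono fun t ht ↦ by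
        simp only [norm_zero]; positivity⟩⟩
    Nat.one_pos
    (fun _ ↦ ⟨?_, ?_, fun h ↦ absurd rfl h⟩)
  rotate_left
  · -- slaving of the 4-velocity: orders 1, 2, 3
    intro m hm1 hm3
    change Tendsto (fun t ↦ iteratedDeriv m
      (fun s ↦ Lorentz.boostCLM (w s) (E4.basisVector 0)) t) atTop (𝓝 0)
    exact tendsto_iteratedDeriv_comp (F := fun v ↦ Lorentz.boostCLM v (E4.basisVector 0))
      (by norm_num : (1 / 4 : ℝ) < 1) (contDiffOn_boostCLM_apply _) hwsmooth hwb
      (fun i _ hi3 ↦ hwlim i hi3) hm1 hm3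
  · -- translational slaving: the expression is `-w`
    intro m hm
    have hfun : (fun s ↦ deriv (fun _ : ℝ ↦ (0 : E3)) s -
        ((((Λ s : E4 ≃L[ℝ] E4) (E4.basisVector 0)) 0)⁻¹ •
          E4.spatial ((Λ s : E4 ≃L[ℝ] E4) (E4.basisVector 0)))) = fun s ↦ -(w s) := by
      funext s
      change deriv (fun _ : ℝ ↦ (0 : E3)) s -
        ((((Lorentz.boost (w s) (hw1 s) : E4 ≃L[ℝ] E4) (E4.basisVector 0)) 0)⁻¹ •
          E4.spatial ((Lorentz.boost (w s) (hw1 s) : E4 ≃L[ℝ] E4) (E4.basisVector 0))) = -(w s)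
      rw [Lorentz.spatial_boost_apply_basisVector_zero, Lorentz.boost_apply_basisVector_zero_zero,
        inv_smul_smul₀ (Lorentz.gamma_pos (hw1 s)).ne', deriv_const, zero_sub]
    change Tendsto (fun t ↦ iteratedDeriv m (fun s ↦ deriv (fun _ : ℝ ↦ (0 : E3)) s -
        ((((Λ s : E4 ≃L[ℝ] E4) (E4.basisVector 0)) 0)⁻¹ •
          E4.spatial ((Λ s : E4 ≃L[ℝ] E4) (E4.basisVector 0)))) t) atTop (𝓝 0)
    rw [hfun]
    simp only [iteratedDeriv_fun_neg]
    simpa using (hwlim m (hm.trans (by norm_num))).neg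
  -- QS forces the weighted 4-velocity rate …
  have hrate := weightedRate_e0_of_QS_one (γ := 2) (κ := 1 / 2) (V := 0) (fun _ ↦ 1) (fun _ ↦ 0)
    (fun _ ↦ Λ) (fun _ _ ↦ 0) rfl one_ne_zero (hΛsmooth.of_le (by exact_mod_cast le_top))
    contDiff_const hγ ⟨by norm_num, by norm_num⟩
    ((eventually_ge_atTop 0).mono fun t ht ↦ by simp only [norm_zero]; positivity)
    (Eventually.of_forall fun t ↦ by simp) hQS
  -- … which fails along `t = 2πn`
  have hev : ∀ᶠ t in atTop, t ^ (3 / 4 : ℝ) *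
      ‖deriv (fun s ↦ ((Λ s : E4 ≃L[ℝ] E4) (E4.basisVector 0))) t‖ < 1 / 8 :=
    (tendsto_order.1 hrate).2 _ (by norm_num)
  obtain ⟨T, hT⟩ := (hev.and (eventually_ge_atTop 1)).exists_forall_of_atTop
  obtain ⟨n, hn⟩ := exists_nat_gt T
  set tn : ℝ := n * (2 * Real.pi) with htn
  have hπ : (1 : ℝ) ≤ 2 * Real.pi := by linarith [Real.pi_gt_three]
  have hn0 : (0 : ℝ) ≤ n := n.cast_nonneg
  have htnT : T ≤ tn := by
    rw [htn]; nlinarith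
  obtain ⟨hlt, htn1⟩ := hT tn htnT
  -- the lower bound at `tn`
  have hsin : Real.sin tn = 0 := by
    have h := Real.sin_nat_mul_pi (2 * n)
    rw [htn, ← h]
    push_cast
    ring_nf
  have hcos : Real.cos tn = 1 := by rw [htn]; exact Real.cos_nat_mul_two_pi n
  have hu0 : u tn = 0 := by rw [hudef]; simp [hsin]
  have hu' : HasDerivAt u (ε * A tn) tn := by
    have h := (hasDerivAt_osc0 hA tn).const_mul ε
    rw [hsin, hcos, mul_zero, zero_add, mul_one] at h
    exact h
  have hV : HasDerivAt (fun s ↦ Lorentz.gamma (w s) • w s) ((ε * A tn) • e) tn :=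
    hasDerivAt_gamma_smul_of_zero he hu' hu0
  have hlow : ε * A tn ≤ ‖deriv (fun s ↦ ((Λ s : E4 ≃L[ℝ] E4) (E4.basisVector 0))) tn‖ := by
    have h1 := norm_deriv_gamma_smul_le hwsmooth hw1 tn
    rw [hV.deriv, norm_smul, he, mul_one, Real.norm_eq_abs,
      abs_of_pos (mul_pos (by norm_num) (hApos tn))] at h1
    exact h1
  have hge : 1 / 8 ≤ tn ^ (3 / 4 : ℝ) * (ε * A tn) := weighted_ampl_ge htn1
  have : 1 / 8 ≤ tn ^ (3 / 4 : ℝ) *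
      ‖deriv (fun s ↦ ((Λ s : E4 ≃L[ℝ] E4) (E4.basisVector 0))) tn‖ :=
    hge.trans (mul_le_mul_of_nonneg_left hlow (Real.rpow_nonneg (by positivity) _))
  linarith

end Summit.FinalStateConjecture.FinalStateConjecture.Theorems.WeightedQuasiStationarity.Negative

end
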